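import Mathlib.Data.Matrix.ColumnRowPartitioned
import Mathlib.Data.Real.Basic
import Mathlib.Tactic.Abel

/-!
# `BalabanUV.Beta.FP.CompositeWardLetters` — road «FP» for binder row D1, ROUTE T branch (β) (jets only): **THE COMPOSITE AVERAGING'S WARD LETTERS, ORDER BY
# ORDER, FROM THE ONE-STEP COVARIANCE LETTERS** — the jet analogue of `NestedStepLawOneShot.compAveraging_mul_gauge_eq_zero` (`Q₁D₁ = 0`, `Q₁D₂ = D̄`, `Q₂D̄ = 0` ⇒
# `(Q₂Q₁)·[D₂|D₁] = 0`): the hypotheses `b0 ∕ b1 ∕ b2` of `NestedStepLawOneShotJets.secondVar_oneShot_nestedStepLaw_jets` (p308750) for the composite jets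
# `𝔔₀ = Q₂₀Q₁₀`, `𝔔₁ = Q₂₁Q₁₀ + Q₂₀Q₁₁`, `𝔔₂ = Q₂₂Q₁₀ + Q₂₁Q₁₁ + (Q₂₁Q₁₁ + Q₂₀Q₁₂)` follow from the ONE-STEP covariance jets `Q₁·W = [D̄ | 0]` and the COARSE
# covariance jets `Q₂·D̄ = 0`, each to second order (Leibniz); iterating, every composite `𝔔`-letter of an `m`-fold averaging reduces to one-step letters level by level

HONEST DEPENDENCY (page 1, mandatory): continuum YM on T⁴ ⇐ BetaPertH ∧ nine spine estimates (0/9 proved); BetaPertH ⇐ (D1) ∧ (D4) ∧ CAP+tail;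
G-an2-4 gates asym, D1 and NE2/3/4.  HONEST FRAMING (cell contract, verbatim): «discharging `BetaPertH` makes Bałaban's UV stability UNCONDITIONAL —
a real constructive-QFT result; it is NOT the continuum limit and NOT the Clay problem.»  ABSOLUTE RULE (cell charter, verbatim): «No internally-minted
statement may enter as a cited fact. Every hypothesis is either kernel-proved in this package or a verbatim quotation of a PUBLISHED theorem with page
reference. The manuscript(s) under audit are NOT citable for their own disputed steps — they are the thing under adjudication; programme-internal
(2001/route/tribunal) claims are never citable.»  THIS MODULE is [folklore] finite-matrix algebra (Mathlib only); no `def`, no `def … : Prop`, nothing cited,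
0 sorry; 0∕4 row-D1 binders; the one-step letters `c0 c1 c2` ∕ `d0 d1 d2` themselves (the torus TABLE IDENTITIES of the literal) are NOT proved here — NOT (T-ID),
NOT SDF, NOT D1, NOT BetaPertH, NOT continuum, NOT Clay.  «not in print; our bookkeeping».

SHAPES (as in p308750): `Q₁ᵢ : Matrix μ ν ℝ` (one-step averaging jets), `Q₂ᵢ : Matrix κ μ ℝ` (coarse averaging jets), `Wᵢ : Matrix ν (ρ₂ ⊕ ρ₁) ℝ` (fine generator jets,
columns = coarse residual ⊕ fine residual parameters), `D̄ᵢ : Matrix μ ρ₂ ℝ` (coarse generator jets).  ONE-STEP LETTERS: `c0 : Q₁₀W₀ = [D̄₀|0]`,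
`c1 : Q₁₁W₀ + Q₁₀W₁ = [D̄₁|0]`, `c2 : Q₁₂W₀ + 2•Q₁₁W₁ + Q₁₀W₂ = [D̄₂|0]` (covariance of the one-step averaging: fine residual gauges are killed, block gauges
descend to the coarse generators — to second order along the background); COARSE LETTERS: `d0 : Q₂₀D̄₀ = 0`, `d1 : Q₂₁D̄₀ + Q₂₀D̄₁ = 0`, `d2 : Q₂₂D̄₀ + 2•Q₂₁D̄₁ + Q₂₀D̄₂ = 0`.
CONCLUSIONS: `compWard_b0 : 𝔔₀W₀ = 0`, `compWard_b1 : 𝔔₁W₀ + 𝔔₀W₁ = 0`, `compWard_b2 : 𝔔₂W₀ + 2•(𝔔₁W₁) + 𝔔₀W₂ = 0`, and the DESCENT `compWard_c0∕c1∕c2` :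
`𝔔·W = [Q₂D̄ | 0]`-jets for a further composition (so an `m`-fold composite's letters unwind level by level).
Provenance: D1 formalisation swarm LEAF PROVER 02, unit b2b-balaban-beta-d1-formalise-leaf-02 gen 16, 2026-08-21 (owner d1-p3 g17 LANDED-4 l.37157: «composite Ward letters ○»).  No existing file touched. -/

namespace Summit.QuantumFields.BalabanUV.Beta.FP.CompositeWardLetters

open Matrix

variable {ν μ κ ρ₁ ρ₂ : Type*}

/-! ## §1 `fromCols` plumbing -/

/-- [folklore] `[A|B] + [A′|B′] = [A+A′ | B+B′]`. -/
theorem fromCols_add (A A' : Matrix μ ρ₂ ℝ) (B B' : Matrix μ ρ₁ ℝ) : fromCols A B + fromCols A' B' = fromCols (A + A') (B + B') := by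
  ext i (j | j) <;> rfl

/-- [folklore] `c • [A|B] = [c•A | c•B]`. -/
theorem smul_fromCols (c : ℝ) (A : Matrix μ ρ₂ ℝ) (B : Matrix μ ρ₁ ℝ) : c • fromCols A B = fromCols (c • A) (c • B) := by
  ext i (j | j) <;> rfl

/-! ## §2 The composite `𝔔`-letters from the one-step letters, order by order -/

section Letters

variable [Fintype ν] [Fintype μ]
variable (Q₁₀ Q₁₁ Q₁₂ : Matrix μ ν ℝ) (Q₂₀ Q₂₁ Q₂₂ : Matrix κ μ ℝ) (W₀ W₁ W₂ : Matrix ν (ρ₂ ⊕ ρ₁) ℝ) (Db₀ Db₁ Db₂ : Matrix μ ρ₂ ℝ)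
  {𝔔₀ 𝔔₁ 𝔔₂ : Matrix κ ν ℝ}

/-- [folklore] **ZEROTH ORDER**: `Q₁₀W₀ = [D̄₀|0]`, `Q₂₀D̄₀ = 0` ⇒ `(Q₂₀Q₁₀)·W₀ = 0`. -/
theorem compWard_b0 (c0 : Q₁₀ * W₀ = fromCols Db₀ 0) (d0 : Q₂₀ * Db₀ = 0) (h𝔔₀ : Q₂₀ * Q₁₀ = 𝔔₀) : 𝔔₀ * W₀ = 0 := by
  rw [← h𝔔₀, Matrix.mul_assoc, c0, mul_fromCols, d0, Matrix.mul_zero, fromCols_zero]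

/-- [folklore] **FIRST ORDER**: `+ c1 : Q₁₁W₀ + Q₁₀W₁ = [D̄₁|0]`, `d1 : Q₂₁D̄₀ + Q₂₀D̄₁ = 0` ⇒ `𝔔₁W₀ + 𝔔₀W₁ = 0` for `𝔔₁ = Q₂₁Q₁₀ + Q₂₀Q₁₁`. -/
theorem compWard_b1 (c0 : Q₁₀ * W₀ = fromCols Db₀ 0) (c1 : Q₁₁ * W₀ + Q₁₀ * W₁ = fromCols Db₁ 0)
    (d1 : Q₂₁ * Db₀ + Q₂₀ * Db₁ = 0) (h𝔔₀ : Q₂₀ * Q₁₀ = 𝔔₀) (h𝔔₁ : Q₂₁ * Q₁₀ + Q₂₀ * Q₁₁ = 𝔔₁) :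
    𝔔₁ * W₀ + 𝔔₀ * W₁ = 0 := by
  have key : 𝔔₁ * W₀ + 𝔔₀ * W₁ = Q₂₁ * (Q₁₀ * W₀) + Q₂₀ * (Q₁₁ * W₀ + Q₁₀ * W₁) := by
    rw [← h𝔔₀, ← h𝔔₁]
    simp only [Matrix.add_mul, Matrix.mul_add, Matrix.mul_assoc]
    abel
  rw [key, c0, c1, mul_fromCols, mul_fromCols, Matrix.mul_zero, Matrix.mul_zero, fromCols_add, add_zero, d1, fromCols_zero]

/-- [folklore] **SECOND ORDER**: `+ c2 : Q₁₂W₀ + 2•Q₁₁W₁ + Q₁₀W₂ = [D̄₂|0]`, `d2 : Q₂₂D̄₀ + 2•Q₂₁D̄₁ + Q₂₀D̄₂ = 0` ⇒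
`𝔔₂W₀ + 2•(𝔔₁W₁) + 𝔔₀W₂ = 0` for `𝔔₂ = Q₂₂Q₁₀ + Q₂₁Q₁₁ + (Q₂₁Q₁₁ + Q₂₀Q₁₂)` (the `b2` hypothesis of p308750, verbatim shape). -/
theorem compWard_b2 (c0 : Q₁₀ * W₀ = fromCols Db₀ 0) (c1 : Q₁₁ * W₀ + Q₁₀ * W₁ = fromCols Db₁ 0)
    (c2 : Q₁₂ * W₀ + (2 : ℝ) • (Q₁₁ * W₁) + Q₁₀ * W₂ = fromCols Db₂ 0)
    (d2 : Q₂₂ * Db₀ + (2 : ℝ) • (Q₂₁ * Db₁) + Q₂₀ * Db₂ = 0)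
    (h𝔔₀ : Q₂₀ * Q₁₀ = 𝔔₀) (h𝔔₁ : Q₂₁ * Q₁₀ + Q₂₀ * Q₁₁ = 𝔔₁) (h𝔔₂ : Q₂₂ * Q₁₀ + Q₂₁ * Q₁₁ + (Q₂₁ * Q₁₁ + Q₂₀ * Q₁₂) = 𝔔₂) :
    𝔔₂ * W₀ + (2 : ℝ) • (𝔔₁ * W₁) + 𝔔₀ * W₂ = 0 := by
  have key : 𝔔₂ * W₀ + (2 : ℝ) • (𝔔₁ * W₁) + 𝔔₀ * W₂ =
      Q₂₂ * (Q₁₀ * W₀) + (2 : ℝ) • (Q₂₁ * (Q₁₁ * W₀ + Q₁₀ * W₁)) + Q₂₀ * (Q₁₂ * W₀ + (2 : ℝ) • (Q₁₁ * W₁) + Q₁₀ * W₂) := by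
    rw [← h𝔔₀, ← h𝔔₁, ← h𝔔₂]
    simp only [Matrix.add_mul, Matrix.mul_add, Matrix.mul_assoc, smul_add, two_smul]
    abel
  rw [key, c0, c1, c2, mul_fromCols, mul_fromCols, mul_fromCols, Matrix.mul_zero, Matrix.mul_zero, Matrix.mul_zero, smul_fromCols, smul_zero,
    fromCols_add, fromCols_add, add_zero, add_zero, d2, fromCols_zero]

/-! ## §3 Descent: the composite averaging's OWN covariance jets (for a further composition) -/

/-- [folklore] zeroth order: `𝔔₀W₀ = [Q₂₀D̄₀ | 0]` — so with the NEXT coarse generators `D̄′₀ := Q₂₀D̄₀`-shaped letters the composite is again a «one-step» datum. -/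
theorem compWard_c0 (c0 : Q₁₀ * W₀ = fromCols Db₀ 0) (h𝔔₀ : Q₂₀ * Q₁₀ = 𝔔₀) : 𝔔₀ * W₀ = fromCols (Q₂₀ * Db₀) 0 := by
  rw [← h𝔔₀, Matrix.mul_assoc, c0, mul_fromCols, Matrix.mul_zero]

/-- [folklore] first order: `𝔔₁W₀ + 𝔔₀W₁ = [Q₂₁D̄₀ + Q₂₀D̄₁ | 0]`. -/
theorem compWard_c1 (c0 : Q₁₀ * W₀ = fromCols Db₀ 0) (c1 : Q₁₁ * W₀ + Q₁₀ * W₁ = fromCols Db₁ 0)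
    (h𝔔₀ : Q₂₀ * Q₁₀ = 𝔔₀) (h𝔔₁ : Q₂₁ * Q₁₀ + Q₂₀ * Q₁₁ = 𝔔₁) :
    𝔔₁ * W₀ + 𝔔₀ * W₁ = fromCols (Q₂₁ * Db₀ + Q₂₀ * Db₁) 0 := by
  have key : 𝔔₁ * W₀ + 𝔔₀ * W₁ = Q₂₁ * (Q₁₀ * W₀) + Q₂₀ * (Q₁₁ * W₀ + Q₁₀ * W₁) := by
    rw [← h𝔔₀, ← h𝔔₁]
    simp only [Matrix.add_mul, Matrix.mul_add, Matrix.mul_assoc]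
    abel
  rw [key, c0, c1, mul_fromCols, mul_fromCols, Matrix.mul_zero, Matrix.mul_zero, fromCols_add, add_zero]

/-- [folklore] second order: `𝔔₂W₀ + 2•(𝔔₁W₁) + 𝔔₀W₂ = [Q₂₂D̄₀ + 2•Q₂₁D̄₁ + Q₂₀D̄₂ | 0]`. -/
theorem compWard_c2 (c0 : Q₁₀ * W₀ = fromCols Db₀ 0) (c1 : Q₁₁ * W₀ + Q₁₀ * W₁ = fromCols Db₁ 0)
    (c2 : Q₁₂ * W₀ + (2 : ℝ) • (Q₁₁ * W₁) + Q₁₀ * W₂ = fromCols Db₂ 0)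
    (h𝔔₀ : Q₂₀ * Q₁₀ = 𝔔₀) (h𝔔₁ : Q₂₁ * Q₁₀ + Q₂₀ * Q₁₁ = 𝔔₁) (h𝔔₂ : Q₂₂ * Q₁₀ + Q₂₁ * Q₁₁ + (Q₂₁ * Q₁₁ + Q₂₀ * Q₁₂) = 𝔔₂) :
    𝔔₂ * W₀ + (2 : ℝ) • (𝔔₁ * W₁) + 𝔔₀ * W₂ = fromCols (Q₂₂ * Db₀ + (2 : ℝ) • (Q₂₁ * Db₁) + Q₂₀ * Db₂) 0 := by
  have key : 𝔔₂ * W₀ + (2 : ℝ) • (𝔔₁ * W₁) + 𝔔₀ * W₂ =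
      Q₂₂ * (Q₁₀ * W₀) + (2 : ℝ) • (Q₂₁ * (Q₁₁ * W₀ + Q₁₀ * W₁)) + Q₂₀ * (Q₁₂ * W₀ + (2 : ℝ) • (Q₁₁ * W₁) + Q₁₀ * W₂) := by
    rw [← h𝔔₀, ← h𝔔₁, ← h𝔔₂]
    simp only [Matrix.add_mul, Matrix.mul_add, Matrix.mul_assoc, smul_add, two_smul]
    abel
  rw [key, c0, c1, c2, mul_fromCols, mul_fromCols, mul_fromCols, Matrix.mul_zero, Matrix.mul_zero, Matrix.mul_zero, smul_fromCols, smul_zero,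
    fromCols_add, fromCols_add, add_zero, add_zero]

end Letters

end Summit.QuantumFields.BalabanUV.Beta.FP.CompositeWardLetters
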